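import Literature.NumberTheory.EllipticCurves.HeegnerPointsKolyvaginPrimaryRamifiedProofs
import HarnessLib

/-!
# Crux `JetchevIrreducibleReadingByName` (item 20165, shared K8-t′ / K9), registered stub S5 `stub_prop44Irred`
# ([McC] Prop. 4.4 "in particular", irreducible reading): the SPLIT form of the stub on McCallum's cocycle —
# `ord d_M(mℓ)_λ = ord c_M(mℓ)_λ` AND `ord c_M(mℓ)_λ = ord c_M(m)_λ` — from the tree's COMBINED form plus one
# image-free local computation (the Frobenius part of `c_M(mℓ)_λ` vanishes) — seat `bsd-potss-k8t-c4` g10;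
# `--supports 20165`, helper; route-free; nothing booked, no item closed, BSD is not proved by any of this

WHY. The registered stub S5 `Sig.stub_prop44Irred` of crux 20165 (skeleton v5, sha 781170fc0df6; = the Literature
fact `McCallum1991.prop44_localOrder_kolyvaginClass_mul_eq` with the tower binder replaced by `E[p]` irreducible) is,
for every `j`, the conjunction (A) `p^j c_M(mℓ) ∈ Sel_λ ↔ p^j c_M(mℓ) ∈ Ker_λ` (`ord d_M(mℓ)_λ = ord c_M(mℓ)_λ`) and
(B) `p^j c_M(mℓ) ∈ Ker_λ ↔ p^j c_M(m) ∈ Ker_λ` (`ord c_M(mℓ)_λ = ord c_M(m)_λ`), where `Sel_λ = selmerLocalKer`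
(dies in `H¹(K_λ, E)`) and `Ker_λ = torsionLocalKer` (dies in `H¹(K_λ, E[p^M])`). The tree PROVES McCallum's
Prop. 4.4 on McCallum's cocycle in the COMBINED form (C) `k c(P₁) ∈ Sel_λ ↔ k c(P₂) ∈ Ker_λ`
(`zsmul_kolyvaginClass_mem_selmerLocalKer_iff_mem_torsionLocalKer`, `HeegnerPointsKolyvaginPrimaryRamifiedProofs` §4,
modulo an abstract reduction datum at `𝔓 ∣ λ`). (A) ∧ (B) ⟸ (A) ∧ (C), and (A) is ONE MORE image-free local
computation, printed as McCallum's *"In particular, `ord d_M(ml)_λ = ord c_M(ml)_λ`"* (Prop. 4.4 (1)+(3)) and as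
Jetchev's `loc_λ κ_{cℓ} ∈ H¹_tr(K_λ)` (Prop. 4.7: `φ_λ(loc_λ κ_c) = loc_λ κ_{cℓ}` with `φ_λ : H¹_ur ⥲ H¹_tr`): the
UNRAMIFIED (Frobenius) component of `c(P₁)_λ` vanishes because the reduction of `P₁ = P_{mℓ}` is `p^M`-DIVISIBLE by a
Frobenius-fixed point of `Ẽ` — `P̃_{mℓ} = Σ_σ σ D_ℓ(…)~ = (ℓ(ℓ+1)/2)·(…)~` with `p^M ∣ ℓ + 1`, `p` odd (Howard 2004
Lemma 2.7.3; the tree's algebraic core `JET.exists_map_derivOp_eq_pow_smul`, bsd-jet p512689). OBSERVATION recorded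
here for the planner: every CONSUMER of S5 in the tree (bsd-jet's `JET.addOrderOf_localization_kolyvaginClass_mul_eq_of_prop44`,
this seat's `…_of_prop44Irred`) uses conjunct (B) ONLY (`(h j).2`).

WHAT IS PROVED (image-free, reduction-type-free; McCallum's cocycle `kolyvaginClass` of
`HeegnerPointsKolyvaginPrimaryClassesProofs`, the tree's Galois-cohomology model; abstract reduction datum as in the
tree's §2/§4):
* §1 `zsmul_kolyvaginClass_mem_torsionLocalKer_of_mem_selmerLocalKer_of_red` — (A), the non-trivial direction: at a
  good place `v ∤ n`, for `P` FIXED by an arithmetic Frobenius `F` at `𝔓 ∣ v` (which fixes `E[n]`) and with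
  reduction `red P ∈ n · Ẽ^{φ = 1}`, every multiple `k c(P)` that is Selmer at `v` is locally TRIVIAL at `v`
  (Gross Prop. 9.6 `[k c(P), F] = k(FQ − Q)`; `red(FQ − Q) = φ(Q̃) − Q̃ = 0` since `nQ̃ = P̃ ∈ n Ẽ^{φ=1}` and `φ`
  fixes `Ẽ[n]`; reduction injective on `E[n]`).
* §1 `zsmul_kolyvaginClass_mem_selmerLocalKer_iff_mem_torsionLocalKer_self_of_red` — (A) as an `iff` (the other
  direction is `torsionLocalKer_le_selmerLocalKer`).
* §2 `zsmul_kolyvaginClass_localOrder_split_of_red` — **(A) ∧ (B) for all `k`**, i.e. the SHAPE of S5 on McCallum's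
  cocycle, from the hypotheses of the tree's combined theorem (reduction datum at `𝔓`, Euler-system root `R₀`,
  `c(P₂)` Selmer at `v`) plus, for `P₁`, a Frobenius `F₁` at the same `𝔓` fixing `E[n]` and `P₁` with a compatible
  reduction Frobenius `φ₁` and `red P₁ ∈ n · Ẽ^{φ₁ = 1}`.
What this does NOT do: it does not construct the reduction datum (reduction of `E(K̄)` modulo `𝔓 ∣ λ`, the
Eichler–Shimura congruence `ỹ_{mℓ} = Frob · ỹ_m`, the point counts of `Ẽ(𝔽_{ℓ²})^±`) for Heegner data — that, and
only that, is what separates S5 from a theorem (for ANY image of `ρ̄`: no hypothesis on the image occurs here or in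
the tree's §4). HONEST FRAMING: theorems about McCallum's cocycle under displayed abstract hypotheses; nothing
asserted about any curve; the stub S5, the crux and BSD stay open.

References: [cite: McCallumLMS1991, §4 Lemma 4.3, Prop. 4.4 (1)–(3) and "In particular" (p. 301), proof (p. 302)]
[cite: GrossLMS1991, Prop. 6.2 (2) and proof (p. 244), §7 (7.1), Prop. 9.6] [cite: Jetchev2008, §4.2 item 4 and
Prop. 4.7 (arXiv p. 11) = printed Prop. 4.4 (p. 821)] [cite: Howard2004HeegnerKolyvagin, Lemma 2.7.3]
[cite: SilvermanAEC2009, VII.3.1(b), VII.4.1].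
-/

set_option autoImplicit false
-- the Theorems directory repeats the summit name (sibling precedent `KatoDescentPotSupersingularAssembly.lean`)
set_option linter.dupNamespace false

noncomputable section

open scoped Classical

open WeierstrassCurve NumberField IsDedekindDomain Field
  Literature.NumberTheory.GaloisRepresentations Literature.NumberTheory.EllipticCurves
  Literature.NumberTheory.EllipticCurves.KolyvaginCocycle

universe u

namespace Summit.BirchSwinnertonDyer.BirchSwinnertonDyer.Theorems.JetchevIrreducibleProp44

variable {K : Type u} [Field K] [NumberField K] (W : WeierstrassCurve K) [W.IsElliptic]

/-! ### §1 (A): a multiple of `c(P)` that is Selmer at `λ` is locally trivial at `λ`, when `P̃ ∈ n·Ẽ^{φ=1}` -/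

/-- **McCallum Prop. 4.4 (1)+(3) / Jetchev Prop. 4.7, the `H¹_tr`-half, on McCallum's cocycle** ("`ord d_M(ml)_λ =
ord c_M(ml)_λ`", non-trivial direction): at a good place `v ∤ n` with local prime `𝔐`, an arithmetic Frobenius `F`
fixing `E[n]` and FIXING `P`, and an additive reduction `red` with `red ∘ F = φ ∘ red`, injective on `E[n]`, `φ`
fixing `B[n]`; if `red P = n • b` with `φ b = b` (the reduction of `P` is `n`-divisible by a Frobenius-fixed
point — for `P = P_{mℓ}` at `λ ∣ ℓ`: `P̃_{mℓ} = (ℓ(ℓ+1)/2)(…)`, Howard Lemma 2.7.3), then for every `k`,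
`k c(P) ∈ selmerLocalKer v ⟹ k c(P) ∈ torsionLocalKer v`. Proof: the Selmer condition at the good place is
"unramified" (`selmerLocalKer_eq_unramifiedKer`), so Gross's criterion Prop. 9.6
(`mem_torsionLocalKer_iff_h1Eval_eq_zero`) applies: `[k c(P), F] = k(FQ − Q)` (`F P = P`), and `k(FQ − Q) ∈ E[n]`
reduces to `φ(kQ̃) − kQ̃ = 0` because `n(kQ̃ − k b) = 0` and `φ` fixes `B[n]` and `b`; reduction is injective on
`E[n]`. Image-free, reduction-type-free. [cite: McCallumLMS1991, Prop. 4.4 (1), (3) (p. 301)]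
[cite: GrossLMS1991, Prop. 9.6, Prop. 6.2 (2) (proof)] [cite: Jetchev2008, Prop. 4.7 (arXiv p. 11)]
[cite: Howard2004HeegnerKolyvagin, Lemma 2.7.3] -/
theorem zsmul_kolyvaginClass_mem_torsionLocalKer_of_mem_selmerLocalKer_of_red {n : ℤ}
    {hdiv : ∀ P : geomPoints W, ∃ Q : geomPoints W, n • Q = P}
    {A : AddSubgroup (geomPoints W)}
    (hA : IsAdmissible (absoluteGaloisGroup K) A n) {P : geomPoints W}
    (hP : P ∈ invPoints (absoluteGaloisGroup K) A n)
    {v : HeightOneSpectrum (𝓞 K)} (hgood : W.HasGoodReductionAt v) (hn : (n : 𝓞 K) ∉ v.asIdeal)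
    (hn0 : n ≠ 0)
    {𝔐 : Ideal (HeightOneSpectrum.localAbsIntegers v)} (h𝔐 : 𝔐 ∈ v.localPrimesAbove)
    {F : absoluteGaloisGroup K}
    (hF : IsArithFrobAt (𝓞 K) F (v.primeBelow (closureEmb (K := K) (v.adicCompletion K)) 𝔐))
    (hFfix : F ∈ torsionFixing W n)
    (hsurj : Function.Surjective (torsionPointsMap W (v.adicCompletion K) n))
    (hFP : F • P = P)
    {B : Type*} [AddCommGroup B] (red : geomPoints W →+ B) (φ : B →+ B)
    (hredF : ∀ x : geomPoints W, red (F • x) = φ (red x))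
    (hred : ∀ x : geomPoints W, n • x = 0 → red x = 0 → x = 0)
    (hBn : ∀ b : B, n • b = 0 → φ b = b)
    (hPred : ∃ b : B, φ b = b ∧ red P = n • b) (k : ℤ)
    (hsel : k • kolyvaginClass W n hdiv hA P hP ∈ selmerLocalKer W (v.adicCompletion K) n) :
    k • kolyvaginClass W n hdiv hA P hP ∈ W.torsionLocalKer (v.adicCompletion K) n := by
  set ι₀ := closureEmb (K := K) (v.adicCompletion K) with hι₀
  set 𝔓 := v.primeBelow ι₀ 𝔐 with h𝔓def
  have h𝔓 : 𝔓 ∈ v.primesAbove := HeightOneSpectrum.primeBelow_mem_primesAbove h𝔐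
  have hvbad : v ∉ W.badPlaces (𝓞 K) := fun h ↦ h hgood
  obtain ⟨Q, hQ⟩ := hdiv P
  -- the class is unramified at `𝔓` (Selmer condition at the good place `v ∤ n`)
  have hunr : k • kolyvaginClass W n hdiv hA P hP ∈ unramifiedKer (geomTorsion W n) 𝔓 := by
    rw [← W.selmerLocalKer_eq_unramifiedKer hgood hn h𝔓]
    exact hsel
  have hcrit := mem_torsionLocalKer_iff_h1Eval_eq_zero W n h𝔐 hF hFfix
    (inertia_le_torsionFixing W hvbad hn ι₀ h𝔐) (isOpen_torsionFixing W hn0) hsurj hunr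
  rw [hcrit, h1Eval_zsmul W n k _ hFfix, kolyvaginClass_eq_cls hA hP hQ]
  unfold KolyvaginCocycle.cls
  rw [h1Eval_oneCocycleClass W n _ hFfix, Subtype.ext_iff]
  change ((k • (F • Q - Q - rootIn A n (F • P - P)) : geomPoints W)) = 0
  rw [hFP, sub_self, rootIn_zero hA.eq_zero_of_zsmul, sub_zero]
  obtain ⟨b₀, hb₀, hPb₀⟩ := hPred
  -- `k • red P = n • (k • b₀)` with `φ (k • b₀) = k • b₀`
  have hb : φ (k • b₀) = k • b₀ := by rw [map_zsmul, hb₀]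
  have hkb : k • red P = n • (k • b₀) := by rw [hPb₀, smul_comm]
  -- `y = kQ` has `n • (red y - k b₀) = 0`, so `φ` fixes `red y`; then `F y - y ∈ E[n] ∩ ker red`
  have hy : φ (red (k • Q)) = red (k • Q) := by
    have h1 : n • (red (k • Q) - k • b₀) = 0 := by
      rw [zsmul_sub, ← map_zsmul, smul_comm, hQ, map_zsmul, hkb, sub_self]
    have h2 := hBn _ h1
    rw [map_sub, hb, sub_left_inj] at h2
    exact h2
  have hval : F • (k • Q) - k • Q = 0 := by
    refine hred _ ?_ ?_
    · rw [zsmul_sub, smul_comm n F, smul_comm n k Q, hQ, smul_comm F k P, hFP, sub_self]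
    · rw [map_sub, hredF, hy, sub_self]
  rw [zsmul_sub, ← smul_comm F k Q]
  exact hval

/-- **(A) as an equivalence** — `k c(P) ∈ selmerLocalKer v ↔ k c(P) ∈ torsionLocalKer v` under the hypotheses of
`zsmul_kolyvaginClass_mem_torsionLocalKer_of_mem_selmerLocalKer_of_red` (the converse is the tree's
`torsionLocalKer_le_selmerLocalKer`: a class dying in `H¹(K_v, E[n])` dies in `H¹(K_v, E)`). McCallum's "`ord d_M(ml)_λ
= ord c_M(ml)_λ`" in the tree's kernel currency. [cite: McCallumLMS1991, Prop. 4.4 "In particular" (p. 301)]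
[cite: GrossLMS1991, §7 (7.4)] -/
theorem zsmul_kolyvaginClass_mem_selmerLocalKer_iff_mem_torsionLocalKer_self_of_red {n : ℤ}
    {hdiv : ∀ P : geomPoints W, ∃ Q : geomPoints W, n • Q = P}
    {A : AddSubgroup (geomPoints W)}
    (hA : IsAdmissible (absoluteGaloisGroup K) A n) {P : geomPoints W}
    (hP : P ∈ invPoints (absoluteGaloisGroup K) A n)
    {v : HeightOneSpectrum (𝓞 K)} (hgood : W.HasGoodReductionAt v) (hn : (n : 𝓞 K) ∉ v.asIdeal)
    (hn0 : n ≠ 0)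
    {𝔐 : Ideal (HeightOneSpectrum.localAbsIntegers v)} (h𝔐 : 𝔐 ∈ v.localPrimesAbove)
    {F : absoluteGaloisGroup K}
    (hF : IsArithFrobAt (𝓞 K) F (v.primeBelow (closureEmb (K := K) (v.adicCompletion K)) 𝔐))
    (hFfix : F ∈ torsionFixing W n)
    (hsurj : Function.Surjective (torsionPointsMap W (v.adicCompletion K) n))
    (hFP : F • P = P)
    {B : Type*} [AddCommGroup B] (red : geomPoints W →+ B) (φ : B →+ B)
    (hredF : ∀ x : geomPoints W, red (F • x) = φ (red x))
    (hred : ∀ x : geomPoints W, n • x = 0 → red x = 0 → x = 0)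
    (hBn : ∀ b : B, n • b = 0 → φ b = b)
    (hPred : ∃ b : B, φ b = b ∧ red P = n • b) (k : ℤ) :
    k • kolyvaginClass W n hdiv hA P hP ∈ selmerLocalKer W (v.adicCompletion K) n ↔
      k • kolyvaginClass W n hdiv hA P hP ∈ W.torsionLocalKer (v.adicCompletion K) n :=
  ⟨zsmul_kolyvaginClass_mem_torsionLocalKer_of_mem_selmerLocalKer_of_red W hA hP hgood hn hn0 h𝔐 hF hFfix hsurj
    hFP red φ hredF hred hBn hPred k,
    fun h ↦ W.torsionLocalKer_le_selmerLocalKer (v.adicCompletion K) n h⟩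

/-! ### §2 The SPLIT form (A) ∧ (B) — the shape of S5 `stub_prop44Irred` on McCallum's cocycle -/

/-- **McCallum Prop. 4.4 "In particular", SPLIT: `ord d_M(mℓ)_λ = ord c_M(mℓ)_λ` AND `ord c_M(mℓ)_λ = ord c_M(m)_λ`**
— for every `k`, `(k c(P₁) ∈ Sel_λ ↔ k c(P₁) ∈ Ker_λ) ∧ (k c(P₁) ∈ Ker_λ ↔ k c(P₂) ∈ Ker_λ)` — the SHAPE of the
registered stub S5 `stub_prop44Irred` of crux 20165 (and of the Literature fact
`McCallum1991.prop44_localOrder_kolyvaginClass_mul_eq`), on McCallum's cocycle: from the hypotheses of the tree's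
COMBINED theorem `zsmul_kolyvaginClass_mem_selmerLocalKer_iff_mem_torsionLocalKer` (reduction datum at `𝔓`, the
arithmetic of `Ẽ(F_λ)`, the inertia action through `⟨σ_ℓ⟩`, the Euler-system root `R₀`, `F P₂ = P₂`, `c(P₂)` Selmer
at `λ`) PLUS, for the (A)-half at `P₁`: an arithmetic Frobenius `F₁` at the same `𝔓` fixing `E[n]` and `P₁` (obtained
from any Frobenius by an inertia correction — `λ_m` is totally ramified in `K_{mℓ}`), a reduction Frobenius `φ₁`
with `red ∘ F₁ = φ₁ ∘ red` fixing `B[n]`, and `red P₁ ∈ n · B^{φ₁ = 1}` (Howard Lemma 2.7.3). No hypothesis on the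
image of `ρ̄`, none on the reduction of `E` at the residue characteristic of `n`. CONDITIONAL on the displayed
abstract data; nothing asserted about Heegner points. [cite: McCallumLMS1991, Prop. 4.4 (p. 301) and proof (p. 302)]
[cite: GrossLMS1991, Prop. 6.2 (2)] [cite: Jetchev2008, Prop. 4.7] [cite: Howard2004HeegnerKolyvagin, Lemma 2.7.3] -/
theorem zsmul_kolyvaginClass_localOrder_split_of_red
    {p : ℕ} (hp : p.Prime) (hp2 : p ≠ 2) {M : ℕ}
    {hdiv : ∀ P : geomPoints W, ∃ Q : geomPoints W, ((p ^ M : ℕ) : ℤ) • Q = P}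
    {A₁ A₂ : AddSubgroup (geomPoints W)}
    (hA₁ : IsAdmissible (absoluteGaloisGroup K) A₁ ((p ^ M : ℕ) : ℤ))
    (hA₂ : IsAdmissible (absoluteGaloisGroup K) A₂ ((p ^ M : ℕ) : ℤ))
    {P₁ P₂ : geomPoints W}
    (hP₁ : P₁ ∈ invPoints (absoluteGaloisGroup K) A₁ ((p ^ M : ℕ) : ℤ))
    (hP₂ : P₂ ∈ invPoints (absoluteGaloisGroup K) A₂ ((p ^ M : ℕ) : ℤ))
    -- the place `λ`
    {v : HeightOneSpectrum (𝓞 K)} (hgood : W.HasGoodReductionAt v) (hpv : (p : 𝓞 K) ∉ v.asIdeal)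
    {𝔐 : Ideal (HeightOneSpectrum.localAbsIntegers v)} (h𝔐 : 𝔐 ∈ v.localPrimesAbove)
    {F : absoluteGaloisGroup K}
    (hF : IsArithFrobAt (𝓞 K) F (v.primeBelow (closureEmb (K := K) (v.adicCompletion K)) 𝔐))
    (hFfix : F ∈ torsionFixing W ((p ^ M : ℕ) : ℤ))
    (hsurj : Function.Surjective (torsionPointsMap W (v.adicCompletion K) ((p ^ M : ℕ) : ℤ)))
    -- the reduction datum at `𝔓`
    {B : Type*} [AddCommGroup B] (red : geomPoints W →+ B) (φ : B →+ B)
    (hredI : ∀ τ ∈ (v.primeBelow (closureEmb (K := K) (v.adicCompletion K)) 𝔐).inertia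
      (absoluteGaloisGroup K), ∀ x : geomPoints W, red (τ • x) = red x)
    (hredF : ∀ x : geomPoints W, red (F • x) = φ (φ (red x)))
    (hred : ∀ x : geomPoints W, ((p ^ M : ℕ) : ℤ) • x = 0 → red x = 0 → x = 0)
    (hBn : ∀ b : B, ((p ^ M : ℕ) : ℤ) • b = 0 → φ (φ b) = b)
    -- the arithmetic of `Ẽ(F_λ) = {φ² = 1}`
    {ℓ : ℕ} {a l' a' : ℤ} (hl' : ((ℓ + 1 : ℕ) : ℤ) = (p : ℤ) ^ M * l')
    (ha' : a = (p : ℤ) ^ M * a')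
    (htors : ∀ b : B, φ (φ b) = b → IsOfFinAddOrder b)
    (hchar : ∀ b : B, φ (φ b) = b → ((ℓ + 1 : ℕ) : ℤ) • b = a • φ b)
    (hcyc : ∀ s : ℤ, s = 1 ∨ s = -1 → ∃ (g : B) (e : ℕ), φ g = s • g ∧ addOrderOf g = p ^ e ∧
        (p : ℤ) ^ e ∣ ((ℓ + 1 : ℕ) : ℤ) - s * a ∧ ¬ (p : ℤ) ^ (e + 1) ∣ ((ℓ + 1 : ℕ) : ℤ) - s * a ∧
        ∀ c : B, φ c = s • c → (∃ k : ℕ, ((p : ℤ) ^ k) • c = 0) → ∃ i : ℤ, c = i • g)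
    -- the Euler-system data at `λ`
    {τ₀ : absoluteGaloisGroup K}
    (hτ₀ : τ₀ ∈ (v.primeBelow (closureEmb (K := K) (v.adicCompletion K)) 𝔐).inertia
      (absoluteGaloisGroup K))
    (hIτ₀ : ∀ τ ∈ (v.primeBelow (closureEmb (K := K) (v.adicCompletion K)) 𝔐).inertia
      (absoluteGaloisGroup K), ∃ i : ℕ, ∀ x ∈ A₁, τ • x = (τ₀ ^ i) • x)
    {R₀ : geomPoints W} (hR₀A : R₀ ∈ A₁) (hR₀ : ((p ^ M : ℕ) : ℤ) • R₀ = τ₀ • P₁ - P₁)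
    (hR₀red : red R₀ = l' • φ (red P₂) - a' • red P₂)
    (hFP₂ : F • P₂ = P₂)
    (hsel₂ : kolyvaginClass W _ hdiv hA₂ P₂ hP₂ ∈
      selmerLocalKer W (v.adicCompletion K) ((p ^ M : ℕ) : ℤ))
    -- the (A)-half data at `P₁`: a Frobenius at `𝔓` fixing `E[n]` and `P₁`, its reduction Frobenius, `P̃₁ ∈ n·Ẽ^{φ₁=1}`
    {F₁ : absoluteGaloisGroup K}
    (hF₁ : IsArithFrobAt (𝓞 K) F₁ (v.primeBelow (closureEmb (K := K) (v.adicCompletion K)) 𝔐))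
    (hF₁fix : F₁ ∈ torsionFixing W ((p ^ M : ℕ) : ℤ)) (hF₁P₁ : F₁ • P₁ = P₁)
    (φ₁ : B →+ B) (hredF₁ : ∀ x : geomPoints W, red (F₁ • x) = φ₁ (red x))
    (hBn₁ : ∀ b : B, ((p ^ M : ℕ) : ℤ) • b = 0 → φ₁ b = b)
    (hP₁red : ∃ b : B, φ₁ b = b ∧ red P₁ = ((p ^ M : ℕ) : ℤ) • b)
    (k : ℤ) :
    (k • kolyvaginClass W _ hdiv hA₁ P₁ hP₁ ∈ selmerLocalKer W (v.adicCompletion K) ((p ^ M : ℕ) : ℤ) ↔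
      k • kolyvaginClass W _ hdiv hA₁ P₁ hP₁ ∈ W.torsionLocalKer (v.adicCompletion K) ((p ^ M : ℕ) : ℤ)) ∧
    (k • kolyvaginClass W _ hdiv hA₁ P₁ hP₁ ∈ W.torsionLocalKer (v.adicCompletion K) ((p ^ M : ℕ) : ℤ) ↔
      k • kolyvaginClass W _ hdiv hA₂ P₂ hP₂ ∈ W.torsionLocalKer (v.adicCompletion K) ((p ^ M : ℕ) : ℤ)) := by
  have hn0 : ((p ^ M : ℕ) : ℤ) ≠ 0 := by exact_mod_cast pow_ne_zero M hp.ne_zero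
  have hnv : ((((p ^ M : ℕ) : ℤ)) : 𝓞 K) ∉ v.asIdeal := by
    rw [Int.cast_natCast, Nat.cast_pow]
    exact fun h ↦ hpv (v.isPrime.mem_of_pow_mem M h)
  -- (A) at `P₁`
  have hA : k • kolyvaginClass W _ hdiv hA₁ P₁ hP₁ ∈ selmerLocalKer W (v.adicCompletion K) ((p ^ M : ℕ) : ℤ) ↔
      k • kolyvaginClass W _ hdiv hA₁ P₁ hP₁ ∈ W.torsionLocalKer (v.adicCompletion K) ((p ^ M : ℕ) : ℤ) :=
    zsmul_kolyvaginClass_mem_selmerLocalKer_iff_mem_torsionLocalKer_self_of_red W hA₁ hP₁ hgood hnv hn0 h𝔐 hF₁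
      hF₁fix hsurj hF₁P₁ red φ₁ hredF₁ hred hBn₁ hP₁red k
  -- (C): the tree's combined Prop. 4.4
  have hC := zsmul_kolyvaginClass_mem_selmerLocalKer_iff_mem_torsionLocalKer W hp hp2 hA₁ hA₂ hP₁ hP₂ hgood hpv
    h𝔐 hF hFfix hsurj red φ hredI hredF hred hBn hl' ha' htors hchar hcyc hτ₀ hIτ₀ hR₀A hR₀ hR₀red hFP₂ hsel₂ k
  exact ⟨hA, hA.symm.trans hC⟩

end Summit.BirchSwinnertonDyer.BirchSwinnertonDyer.Theorems.JetchevIrreducibleProp44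

end
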